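import Literature.AlgebraicGeometry.Deformation.MorphismLiftsSquareZeroAffine
import Mathlib.RingTheory.Localization.Basic
import HarnessLib

/-!
# The affine lift-torsor on overlaps: restriction of the derivation to a smaller affine open of the target
# (SGA 1 III Prop. 5.1, global layer (iv): comparing two local lifts in a common basic open)

Layer `Literature/AlgebraicGeometry/Deformation`, namespace `Literature.AlgebraicGeometry.Deformation`.
THEOREMS ONLY (no definition, no named fact, no instance).  Fourth file of the DEF-MOR chain (★ (ii)
`MorphismLiftsSquareZeroAffine`, ★ (v) `…Functorial`, (iv)-sheaf `…Glue`).

To let a compatible FAMILY of chart derivations act on a global lift ([SGA1, Exp. III §5]: «l'ensemble des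
prolongements globaux est un espace principal homogène sous `H⁰(Y, 𝒢)`»), the local second lifts `g₂^α : U_α → X`
(through affine opens `V_α` of `X`) must be compared on the overlaps `U_α ∩ U_β`, where they land in DIFFERENT affine
opens `V_α`, `V_β`; one compares them in a common smaller affine open `V′ ⊆ V_α ∩ V_β` which is a basic open of both
(Mathlib `exists_basicOpen_le_affine_inter`), i.e. `Γ(X, V′)` is a LOCALISATION of `Γ(X, V_α)` and of `Γ(X, V_β)`.
This file proves that the torsor is compatible with such a shrinking of the target open:

* §0 ALGEBRA: `Derivation.eq_of_apply_algebraMap_eq_of_isLocalization` — two `R`-derivations on a localisation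
  `A′ = M⁻¹A` with values in an `A′`-module agree as soon as they agree on `A` (the quotient rule; [SGA1, Exp. II
  Cor. 4.4]-type compatibility of `Ω¹` with localisation, in the only form needed here);
* §1 `map_comp_chart` — the chart of `g : Spec C → X` in a smaller target open `V′ ≤ V` restricts the chart in `V`
  (Mathlib `Scheme.Hom.map_appLE`);
* §2 **`charts_eq_add_of_derivation_restrict`** — for `S`-lifts `s, t : Spec C → X` agreeing on the square-zero
  `Spec C₀`, landing in the affine opens `V′ ≤ V` with `Γ(X, V′)` a localisation of `Γ(X, V)`: if an `R₀`-derivation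
  `D′ : Γ(X, V′) → ker π` restricts along `Γ(X, V) → Γ(X, V′)` to the difference of the `V`-charts `ψ_V(t) − ψ_V(s)`, then
  `ψ_{V′}(t) = ψ_{V′}(s) + D′` — the `V′`-derivation of the pair IS `D′` (★ (ii) uniqueness in `V′` + §0);
* §3 **`eq_of_derivations_restrict`** — THE OVERLAP CRITERION: two `S`-lifts `t₁, t₂ : Spec C → X` of the same `s`
  through `V_α`, `V_β`, both landing in a common affine `V′ ≤ V_α ⊓ V_β` that is a localisation of both, whose
  `V_α`- (resp. `V_β`-) derivations restrict from ONE `R₀`-derivation `D′` on `Γ(X, V′)`, are EQUAL.  This is the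
  hypothesis `pullback.fst ≫ g₂^α = pullback.snd ≫ g₂^β` of ★ `existsUnique_glue_of_lifts`, tested on affine charts
  of the overlap (★ `eq_of_forall_exists_chart_eq`).

Cell hodgecm-mathlib (D-0151), SOCKETS-F §4 (α) node E3 brick DEF-MOR (iv)-action on overlaps (A-p01 (g8) census
`E-census-E3E5` §1.3 row E3.1); count-neutral generic capital.  HC_CM is proved only modulo the 7 printed citations
until rung 0 closes; this file discharges none of them.

## References
* [SGA1] A. Grothendieck, M. Raynaud, *Revêtements étales et groupe fondamental (SGA 1)*, LNM 224 / arXiv:math/0206203: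
  Exp. III §5 Prop. 5.1 and the paragraph before it (arXiv ed. pp. 70–71, held `paper:arxiv-math_0206203` p0049).
* [MumfordFogartyKirwan1994] *Geometric Invariant Theory*, 3rd ed., Ch. 6 §3 Prop. 6.15 (pp. 130–131): consumer.
-/

universe u

open CategoryTheory CategoryTheory.Limits AlgebraicGeometry

noncomputable section

namespace Literature.AlgebraicGeometry.Deformation

/-! ### §0 Derivations on a localisation are determined on the original ring -/

/-- **Two `R`-derivations on a localisation `A′ = M⁻¹A`, with values in an `A′`-module, which agree on (the image
of) `A` are equal** — the quotient rule: `s · D(a/s) = D(a) − (a/s) · D(s)` and `s` acts invertibly.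
[cite: SGA1, Exp. III §5 Prop. 5.1] -/
theorem Derivation.eq_of_apply_algebraMap_eq_of_isLocalization {R A A' N : Type*} [CommRing R] [CommRing A]
    [CommRing A'] [Algebra R A'] [Algebra A A'] (M : Submonoid A) [IsLocalization M A'] [AddCommGroup N]
    [Module A' N] [Module R N] {D D' : _root_.Derivation R A' N}
    (h : ∀ a : A, D (algebraMap A A' a) = D' (algebraMap A A' a)) : D = D' := by
  ext x
  obtain ⟨⟨a, s⟩, rfl⟩ := IsLocalization.mk'_surjective M x
  have key : ∀ E : _root_.Derivation R A' N,
      algebraMap A A' s • E (IsLocalization.mk' A' a s) =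
        E (algebraMap A A' a) - IsLocalization.mk' A' a s • E (algebraMap A A' s) := by
    intro E
    have hl := E.leibniz (IsLocalization.mk' A' a s) (algebraMap A A' (s : A))
    rw [IsLocalization.mk'_spec] at hl
    rw [hl]; abel
  have hu : IsUnit (algebraMap A A' (s : A)) := IsLocalization.map_units A' s
  exact (hu.smul_left_cancel).mp (by rw [key D, key D', h a, h s])

/-! ### §1 Charts in a smaller target open -/

section Chart

variable {X : Scheme.{u}} {V V' : X.Opens} (hle : V' ≤ V) {C : Type u} [CommRing C]

/-- **Restricting the target open restricts the chart**: for `g : Spec C → X` landing in `V′ ≤ V`,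
`res_{V,V′} ≫ ψ_{V′}(g) = ψ_V(g)` (Mathlib `Scheme.Hom.map_appLE`). [cite: SGA1, Exp. III §5 Prop. 5.1] -/
theorem map_comp_chart (g : Spec (.of C) ⟶ X) (hg : g ⁻¹ᵁ V = ⊤) (hg' : g ⁻¹ᵁ V' = ⊤) :
    X.presheaf.map (homOfLE hle).op ≫ (g.appLE V' ⊤ hg'.ge ≫ (Scheme.ΓSpecIso (.of C)).hom) =
      g.appLE V ⊤ hg.ge ≫ (Scheme.ΓSpecIso (.of C)).hom := by
  rw [← Category.assoc, Scheme.Hom.map_appLE]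

/-- Pointwise form of `map_comp_chart`. [cite: SGA1, Exp. III §5 Prop. 5.1] -/
theorem chart_map_apply (g : Spec (.of C) ⟶ X) (hg : g ⁻¹ᵁ V = ⊤) (hg' : g ⁻¹ᵁ V' = ⊤) (a : Γ(X, V)) :
    (g.appLE V' ⊤ hg'.ge ≫ (Scheme.ΓSpecIso (.of C)).hom).hom (X.presheaf.map (homOfLE hle).op a) =
      (g.appLE V ⊤ hg.ge ≫ (Scheme.ΓSpecIso (.of C)).hom).hom a := by
  rw [← map_comp_chart hle g hg hg']; rfl

end Chart

/-! ### §2 The `V′`-derivation of a pair is the restriction of a `V`-level derivation -/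

section Restrict

variable {X : Scheme.{u}} {V V' : X.Opens} {R₀ C C₀ : Type u} [CommRing R₀] [CommRing C] [CommRing C₀]
  [Algebra R₀ C] (p : X ⟶ Spec (.of R₀)) (π : C →+* C₀)

/-- **Restriction of the torsor to a smaller affine open of the target.**  Let `V′ ≤ V` be affine opens with
`Γ(X, V′)` a localisation of `Γ(X, V)` (e.g. `V′ = X.basicOpen f`, Mathlib `IsAffineOpen.isLocalization_basicOpen`),
`s t : Spec C → X` two `S`-lifts landing in `V′` (hence in `V`) and agreeing on the square-zero `Spec C₀`.  If an
`R₀`-derivation `D′ : Γ(X, V′) → ker π` (module structure through the `V′`-chart of `s`) satisfies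
`D′ (a|_{V′}) = ψ_V(t)(a) − ψ_V(s)(a)` for all `a ∈ Γ(X, V)`, then `ψ_{V′}(t) = ψ_{V′}(s) + D′`: the derivation attached to
`(s, t)` by ★ `existsUnique_derivation_of_lifts` in `V′` is `D′`. [cite: SGA1, Exp. III §5 Prop. 5.1] -/
theorem charts_eq_add_of_derivation_restrict (hV' : IsAffineOpen V') (hle : V' ≤ V) (M : Submonoid Γ(X, V))
    (hloc : letI : Algebra Γ(X, V) Γ(X, V') := (X.presheaf.map (homOfLE hle).op).hom.toAlgebra
      IsLocalization M Γ(X, V'))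
    (hπ2 : RingHom.ker π ^ 2 = ⊥) (s t : Spec (.of C) ⟶ X)
    (ws : s ≫ p = Spec.map (CommRingCat.ofHom (algebraMap R₀ C)))
    (wt : t ≫ p = Spec.map (CommRingCat.ofHom (algebraMap R₀ C)))
    (h₀ : Spec.map (CommRingCat.ofHom π) ≫ s = Spec.map (CommRingCat.ofHom π) ≫ t)
    (hsV : s ⁻¹ᵁ V = ⊤) (htV : t ⁻¹ᵁ V = ⊤) (hsV' : s ⁻¹ᵁ V' = ⊤) (htV' : t ⁻¹ᵁ V' = ⊤)
    (D' : letI : Algebra R₀ Γ(X, V') := ((Scheme.ΓSpecIso (.of R₀)).inv ≫ p.appLE ⊤ V' le_top).hom.toAlgebra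
      letI : Algebra Γ(X, V') C := (s.appLE V' ⊤ hsV'.ge ≫ (Scheme.ΓSpecIso (.of C)).hom).hom.toAlgebra
      _root_.Derivation R₀ Γ(X, V') (RingHom.ker π))
    (hD' : ∀ a : Γ(X, V), (D' (X.presheaf.map (homOfLE hle).op a) : C) =
      (t.appLE V ⊤ htV.ge ≫ (Scheme.ΓSpecIso (.of C)).hom).hom a -
        (s.appLE V ⊤ hsV.ge ≫ (Scheme.ΓSpecIso (.of C)).hom).hom a)
    (a' : Γ(X, V')) :
    (t.appLE V' ⊤ htV'.ge ≫ (Scheme.ΓSpecIso (.of C)).hom).hom a' =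
      (s.appLE V' ⊤ hsV'.ge ≫ (Scheme.ΓSpecIso (.of C)).hom).hom a' + (D' a' : C) := by
  letI : Algebra R₀ Γ(X, V') := ((Scheme.ΓSpecIso (.of R₀)).inv ≫ p.appLE ⊤ V' le_top).hom.toAlgebra
  letI : Algebra Γ(X, V') C := (s.appLE V' ⊤ hsV'.ge ≫ (Scheme.ΓSpecIso (.of C)).hom).hom.toAlgebra
  obtain ⟨E, hE, -⟩ := existsUnique_derivation_of_lifts p π hV' hπ2 s t ws wt h₀ hsV' htV'
  -- `E` and `D′` agree on the image of `Γ(X, V)`, hence coincide (`Γ(X, V′)` is a localisation of `Γ(X, V)`)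
  have hED : E = D' := by
    letI : Algebra Γ(X, V) Γ(X, V') := (X.presheaf.map (homOfLE hle).op).hom.toAlgebra
    haveI : IsLocalization M Γ(X, V') := hloc
    refine Derivation.eq_of_apply_algebraMap_eq_of_isLocalization M fun a => Subtype.ext ?_
    change (E (X.presheaf.map (homOfLE hle).op a) : C) = (D' (X.presheaf.map (homOfLE hle).op a) : C)
    rw [hD' a, ← chart_map_apply hle t htV htV' a, ← chart_map_apply hle s hsV hsV' a, hE]
    exact (add_sub_cancel_left _ _).symm
  rw [hE a', hED]

end Restrict

/-! ### §3 The overlap criterion -/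

section Overlap

variable {X : Scheme.{u}} {Vα Vβ V' : X.Opens} {R₀ C C₀ : Type u} [CommRing R₀] [CommRing C] [CommRing C₀]
  [Algebra R₀ C] (p : X ⟶ Spec (.of R₀)) (π : C →+* C₀)

/-- **Two local second lifts agree on (an affine chart of) the overlap when their derivations come from one
derivation in a common basic open.**  `s : Spec C → X` (the restriction of the first global lift to a test chart of
`U_α ∩ U_β`), `t₁, t₂ : Spec C → X` (the restrictions of the local second lifts `g₂^α`, `g₂^β`): `S`-lifts agreeing with
`s` on the square-zero `Spec C₀`, `t₁` through `V_α`, `t₂` through `V_β`, all three landing in an affine `V′ ≤ V_α ⊓ V_β`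
with `Γ(X, V′)` a localisation of `Γ(X, V_α)` AND of `Γ(X, V_β)` (Mathlib `exists_basicOpen_le_affine_inter`); if ONE
`R₀`-derivation `D′` on `Γ(X, V′)` restricts to `ψ_{V_α}(t₁) − ψ_{V_α}(s)` on `Γ(X, V_α)` and to `ψ_{V_β}(t₂) − ψ_{V_β}(s)` on
`Γ(X, V_β)`, then `t₁ = t₂`.  (This is the overlap hypothesis of ★ `existsUnique_glue_of_lifts` on the chart `Spec C`,
cf. ★ `eq_of_forall_exists_chart_eq`.) [cite: SGA1, Exp. III §5 Prop. 5.1]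
[cite: MumfordFogartyKirwan1994, Ch. 6 §3 Prop. 6.15 (pp. 130–131)] -/
theorem eq_of_derivations_restrict (hV' : IsAffineOpen V') (hα : V' ≤ Vα) (hβ : V' ≤ Vβ)
    (Mα : Submonoid Γ(X, Vα)) (Mβ : Submonoid Γ(X, Vβ))
    (hlocα : letI : Algebra Γ(X, Vα) Γ(X, V') := (X.presheaf.map (homOfLE hα).op).hom.toAlgebra
      IsLocalization Mα Γ(X, V'))
    (hlocβ : letI : Algebra Γ(X, Vβ) Γ(X, V') := (X.presheaf.map (homOfLE hβ).op).hom.toAlgebra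
      IsLocalization Mβ Γ(X, V'))
    (hπ2 : RingHom.ker π ^ 2 = ⊥) (s t₁ t₂ : Spec (.of C) ⟶ X)
    (ws : s ≫ p = Spec.map (CommRingCat.ofHom (algebraMap R₀ C)))
    (wt₁ : t₁ ≫ p = Spec.map (CommRingCat.ofHom (algebraMap R₀ C)))
    (wt₂ : t₂ ≫ p = Spec.map (CommRingCat.ofHom (algebraMap R₀ C)))
    (h₁ : Spec.map (CommRingCat.ofHom π) ≫ s = Spec.map (CommRingCat.ofHom π) ≫ t₁)
    (h₂ : Spec.map (CommRingCat.ofHom π) ≫ s = Spec.map (CommRingCat.ofHom π) ≫ t₂)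
    (hsα : s ⁻¹ᵁ Vα = ⊤) (hsβ : s ⁻¹ᵁ Vβ = ⊤) (hsV' : s ⁻¹ᵁ V' = ⊤)
    (ht₁α : t₁ ⁻¹ᵁ Vα = ⊤) (ht₁V' : t₁ ⁻¹ᵁ V' = ⊤) (ht₂β : t₂ ⁻¹ᵁ Vβ = ⊤) (ht₂V' : t₂ ⁻¹ᵁ V' = ⊤)
    (D' : letI : Algebra R₀ Γ(X, V') := ((Scheme.ΓSpecIso (.of R₀)).inv ≫ p.appLE ⊤ V' le_top).hom.toAlgebra
      letI : Algebra Γ(X, V') C := (s.appLE V' ⊤ hsV'.ge ≫ (Scheme.ΓSpecIso (.of C)).hom).hom.toAlgebra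
      _root_.Derivation R₀ Γ(X, V') (RingHom.ker π))
    (hDα : ∀ a : Γ(X, Vα), (D' (X.presheaf.map (homOfLE hα).op a) : C) =
      (t₁.appLE Vα ⊤ ht₁α.ge ≫ (Scheme.ΓSpecIso (.of C)).hom).hom a -
        (s.appLE Vα ⊤ hsα.ge ≫ (Scheme.ΓSpecIso (.of C)).hom).hom a)
    (hDβ : ∀ b : Γ(X, Vβ), (D' (X.presheaf.map (homOfLE hβ).op b) : C) =
      (t₂.appLE Vβ ⊤ ht₂β.ge ≫ (Scheme.ΓSpecIso (.of C)).hom).hom b -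
        (s.appLE Vβ ⊤ hsβ.ge ≫ (Scheme.ΓSpecIso (.of C)).hom).hom b) :
    t₁ = t₂ := by
  have e₁ := charts_eq_add_of_derivation_restrict p π hV' hα Mα hlocα hπ2 s t₁ ws wt₁ h₁ hsα ht₁α hsV' ht₁V' D' hDα
  have e₂ := charts_eq_add_of_derivation_restrict p π hV' hβ Mβ hlocβ hπ2 s t₂ ws wt₂ h₂ hsβ ht₂β hsV' ht₂V' D' hDβ
  rw [eq_specMap_appLE_comp_fromSpec hV' t₁ ht₁V', eq_specMap_appLE_comp_fromSpec hV' t₂ ht₂V']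
  congr 2
  ext a'
  rw [e₁ a', e₂ a']

end Overlap

end Literature.AlgebraicGeometry.Deformation

end
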